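import Literature.NumberTheory.EllipticCurves.TwoTorsionCardProofs
import Literature.NumberTheory.EllipticCurves.OrdinaryPrimesProofs
import Literature.NumberTheory.EllipticCurves.GlobalMinimalModel
import Literature.NumberTheory.NumberFields.CubicFieldExplicit
import Mathlib.GroupTheory.Perm.Cycle.Type
import HarnessLib

/-!
# Parity of the trace of Frobenius and roots of the 2-division cubic

Route `ResidualThetaTransportAtTwo`, crux K0⁺ `HeckeThetaPartnerAdicAtTwo` (stmt-BirchSwinnertonDyer-20690),
helper §A2 of the line "proof from print".  THEOREMS ONLY (no definition, no named fact, no `sorry`).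

* `ncard_setOf_neg_eq_eq` — over a field with `2 ≠ 0`, for a Weierstrass curve with `Δ ≠ 0`, the points
  `P` with `−P = P` are `O` and the `(x, −(a₁x+a₃)/2)` with `x` a root of the 2-division cubic
  `4x³ + b₂x² + 2b₄x + b₆`: their number is `1 + #{roots}`;
* `natCard_point_modEq` — hence `#E(F) ≡ 1 + #{roots} (mod 2)` for finite `F` (the involution
  `P ↦ −P`);
* `even_frobeniusTrace_add_one_add_card_roots` — for a globally minimal `W/ℚ` and an odd prime `ℓ ∤ Δ_min`:
  `a_ℓ(W) + 1 + #{x ∈ 𝔽_ℓ : h_W(x) = 0}` is even, where `h_W = X³ + b₂X² + 8b₄X + 16b₆ = 16ψ₂(X/4)`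
  is the monic integral 2-division cubic (the tree's `MonicCubic.poly b₂ (8b₄) (16b₆)`).
-/

set_option autoImplicit false
set_option linter.dupNamespace false

noncomputable section

open WeierstrassCurve Polynomial
open Literature.NumberTheory.EllipticCurves Literature.NumberTheory.NumberFields

namespace Summit.BirchSwinnertonDyer.BirchSwinnertonDyer.Theorems.HeckeThetaPartner

section Field

variable {F : Type*} [Field F] [DecidableEq F] (E : WeierstrassCurve F)

omit [DecidableEq F] in
/-- A point with `−P = P`, `P = (x, y)`: `2y + a₁x + a₃ = 0` and `x` is a root of the 2-division cubic
(`(2y + a₁x + a₃)² − (4x³ + b₂x² + 2b₄x + b₆)` is `4 ×` the Weierstrass equation). [folklore] -/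
theorem isRoot_twoTorsionPolynomial_of_neg_eq {x y : F} {h : E.toAffine.Nonsingular x y}
    (hP : -Affine.Point.some x y h = Affine.Point.some x y h) :
    2 * y + E.a₁ * x + E.a₃ = 0 ∧ E.twoTorsionPolynomial.toPoly.IsRoot x := by
  rw [Affine.Point.neg_some, Affine.Point.some.injEq] at hP
  have hy : 2 * y + E.a₁ * x + E.a₃ = 0 := by
    have := hP.2
    rw [Affine.negY] at this
    linear_combination -this
  refine ⟨hy, ?_⟩
  have heq : y ^ 2 + E.a₁ * x * y + E.a₃ * y = x ^ 3 + E.a₂ * x ^ 2 + E.a₄ * x + E.a₆ :=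
    (Affine.equation_iff _ _).mp h.left
  simp only [twoTorsionPolynomial, Cubic.toPoly, IsRoot.def, eval_add, eval_mul, eval_C, eval_pow,
    eval_X, b₂, b₄, b₆]
  linear_combination (2 * y + E.a₁ * x + E.a₃) * hy - 4 * heq

/-- **The points with `−P = P` are `O` and the points above the roots of the 2-division cubic**:
`#{P : −P = P} = 1 + #{x : 4x³ + b₂x² + 2b₄x + b₆ = 0}` (`2 ≠ 0`, `Δ ≠ 0`; Silverman, *AEC* III.2.3 and
Ex. 3.7). [folklore] -/
theorem ncard_setOf_neg_eq_eq (h2 : (2 : F) ≠ 0) (hΔ : E.Δ ≠ 0) :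
    {P : E.toAffine.Point | -P = P}.ncard = 1 + E.twoTorsionPolynomial.toPoly.roots.toFinset.card := by
  set g : F[X] := E.twoTorsionPolynomial.toPoly with hg
  have h4 : (4 : F) ≠ 0 := by
    rw [show (4 : F) = 2 * 2 by norm_num]
    exact mul_ne_zero h2 h2
  have hg0 : g ≠ 0 := Cubic.ne_zero_of_a_ne_zero (P := E.twoTorsionPolynomial) h4
  -- the coordinate map and its image
  let xo : E.toAffine.Point → Option F := fun P ↦ match P with
    | .zero => none
    | .some x _ _ => some x
  set T : Set (Option F) := insert none ((fun x : F ↦ (some x : Option F)) '' {x | g.IsRoot x}) with hT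
  have hroots : {x | g.IsRoot x} = (g.roots.toFinset : Set F) := by
    ext x
    simp [Polynomial.mem_roots hg0]
  have hnot : none ∉ (fun x : F ↦ (some x : Option F)) '' {x | g.IsRoot x} := by
    rintro ⟨x, -, hx⟩
    exact Option.some_ne_none x hx
  have hTcard : T.ncard = 1 + g.roots.toFinset.card := by
    rw [hT, Set.ncard_insert_of_notMem hnot (by rw [hroots]; exact (g.roots.toFinset.finite_toSet).image _),
      Set.ncard_image_of_injective _ (Option.some_injective F), hroots, Set.ncard_coe_finset, add_comm]
  have hmaps : Set.MapsTo xo {P : E.toAffine.Point | -P = P} T := by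
    rintro (_ | ⟨x, y, h⟩) hP
    · exact Set.mem_insert _ _
    · exact Set.mem_insert_of_mem _ ⟨x, (isRoot_twoTorsionPolynomial_of_neg_eq E hP).2, rfl⟩
  have hinj : Set.InjOn xo {P : E.toAffine.Point | -P = P} := by
    rintro (_ | ⟨x₁, y₁, h₁⟩) hP (_ | ⟨x₂, y₂, h₂⟩) hQ hPQ
    · rfl
    · exact absurd hPQ (by simp [xo])
    · exact absurd hPQ (by simp [xo])
    · have hx : x₁ = x₂ := by simpa [xo] using hPQ
      subst hx
      have hy₁ := (isRoot_twoTorsionPolynomial_of_neg_eq E hP).1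
      have hy₂ := (isRoot_twoTorsionPolynomial_of_neg_eq E hQ).1
      have hy : y₁ = y₂ := by
        have : (2 : F) * (y₁ - y₂) = 0 := by linear_combination hy₁ - hy₂
        exact sub_eq_zero.mp ((mul_eq_zero.mp this).resolve_left h2)
      subst hy
      rfl
  have hsurj : Set.SurjOn xo {P : E.toAffine.Point | -P = P} T := by
    intro t ht
    rcases ht with rfl | ⟨x, hx, rfl⟩
    · exact ⟨0, by simp, rfl⟩
    · have hx' : 4 * x ^ 3 + E.b₂ * x ^ 2 + 2 * E.b₄ * x + E.b₆ = 0 := by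
        have := hx
        simp only [Set.mem_setOf_eq, hg, twoTorsionPolynomial, Cubic.toPoly, IsRoot.def, eval_add,
          eval_mul, eval_C, eval_pow, eval_X] at this
        linear_combination this
      have heq := equation_of_twoTorsionPolynomial_root E h2 hx'
      have hns : E.toAffine.Nonsingular x (-(E.a₁ * x + E.a₃) / 2) :=
        (Affine.equation_iff_nonsingular_of_Δ_ne_zero hΔ).mp heq
      refine ⟨Affine.Point.some _ _ hns, ?_, rfl⟩
      show -Affine.Point.some _ _ hns = Affine.Point.some _ _ hns
      rw [Affine.Point.neg_some, Affine.Point.some.injEq]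
      exact ⟨rfl, negY_twoTorsion E h2 x⟩
  rw [← hTcard, ← hsurj.image_eq_of_mapsTo hmaps, hinj.ncard_image]

/-- **`#E(F) ≡ 1 + #{roots of the 2-division cubic} (mod 2)`** for a Weierstrass curve with `Δ ≠ 0`
over a finite field with `2 ≠ 0`: the involution `P ↦ −P` of the finite set `E(F)` has
`#E(F) ≡ #{P : −P = P} (mod 2)`. [folklore] -/
theorem natCard_point_modEq [Finite E.toAffine.Point] (h2 : (2 : F) ≠ 0) (hΔ : E.Δ ≠ 0) :
    Nat.card E.toAffine.Point % 2 = (1 + E.twoTorsionPolynomial.toPoly.roots.toFinset.card) % 2 := by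
  classical
  haveI := Fintype.ofFinite E.toAffine.Point
  let f : Function.End E.toAffine.Point := fun P => -P
  have hf : f ^ 2 ^ 1 = 1 := by
    rw [pow_one, sq]
    funext P
    exact neg_neg P
  have h := Equiv.Perm.card_fixedPoints_modEq (p := 2) (n := 1) hf
  have hfix : (Function.fixedPoints f).ncard = {P : E.toAffine.Point | -P = P}.ncard := rfl
  rw [Nat.card_eq_fintype_card, ← ncard_setOf_neg_eq_eq E h2 hΔ, ← hfix, ← Nat.card_coe_set_eq,
    Nat.card_eq_fintype_card]
  exact h

end Field

/-! ### The curve over `ℚ`: `a_ℓ(W) ≡ 1 + #{roots of h_W mod ℓ} (mod 2)` -/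

section Curve

variable (W : WeierstrassCurve ℚ) [W.IsGloballyMinimal]

/-- Roots of `h_W = X³ + b₂X² + 8b₄X + 16b₆ = 16 ψ₂(X/4)` modulo an odd prime `ℓ` are `4 ×` the roots
of the 2-division cubic `ψ₂ = 4X³ + b₂X² + 2b₄X + b₆` of the reduced curve. [folklore] -/
theorem card_roots_twoDivisionCubic_eq {ℓ : ℕ} [Fact ℓ.Prime] (hℓ2 : ℓ ≠ 2) :
    ((MonicCubic.poly (integralModelInt W).b₂ (8 * (integralModelInt W).b₄)
        (16 * (integralModelInt W).b₆)).map (Int.castRingHom (ZMod ℓ))).roots.toFinset.card =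
      ((integralModelInt W).map (Int.castRingHom (ZMod ℓ))).twoTorsionPolynomial.toPoly.roots.toFinset.card := by
  set E := (integralModelInt W).map (Int.castRingHom (ZMod ℓ)) with hE
  set hb : (ZMod ℓ)[X] := (MonicCubic.poly (integralModelInt W).b₂ (8 * (integralModelInt W).b₄)
        (16 * (integralModelInt W).b₆)).map (Int.castRingHom (ZMod ℓ)) with hhb
  set ψ : (ZMod ℓ)[X] := E.twoTorsionPolynomial.toPoly with hψ
  have h2 : (2 : ZMod ℓ) ≠ 0 := by
    intro h
    have := (ZMod.natCast_eq_zero_iff 2 ℓ).mp (by exact_mod_cast h)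
    exact hℓ2 ((Nat.prime_dvd_prime_iff_eq (Fact.out) Nat.prime_two).mp this)
  have h4 : (4 : ZMod ℓ) ≠ 0 := by
    rw [show (4 : ZMod ℓ) = 2 * 2 by norm_num]
    exact mul_ne_zero h2 h2
  have hψ0 : ψ ≠ 0 := Cubic.ne_zero_of_a_ne_zero (P := E.twoTorsionPolynomial) h4
  have hmonic : hb.Monic := (MonicCubic.monic_poly _ _ _).map _
  have hb0 : hb ≠ 0 := hmonic.ne_zero
  -- evaluations
  have hevb : ∀ z : ZMod ℓ, hb.eval z = z ^ 3 + ((integralModelInt W).b₂ : ZMod ℓ) * z ^ 2 +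
      8 * ((integralModelInt W).b₄ : ZMod ℓ) * z + 16 * ((integralModelInt W).b₆ : ZMod ℓ) := by
    intro z
    simp only [hhb, MonicCubic.poly, Polynomial.map_add, Polynomial.map_mul, Polynomial.map_pow, map_X,
      Polynomial.map_C, Int.coe_castRingHom, Int.cast_mul, Int.cast_ofNat, eval_add, eval_mul, eval_pow,
      eval_X, eval_C]
  have hevψ : ∀ x : ZMod ℓ, ψ.eval x = 4 * x ^ 3 + ((integralModelInt W).b₂ : ZMod ℓ) * x ^ 2 +
      2 * ((integralModelInt W).b₄ : ZMod ℓ) * x + ((integralModelInt W).b₆ : ZMod ℓ) := by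
    intro x
    simp only [hψ, hE, twoTorsionPolynomial, Cubic.toPoly, map_b₂, map_b₄, map_b₆, eq_intCast, eval_add,
      eval_mul, eval_C, eval_pow, eval_X]
  have hkey : ∀ x : ZMod ℓ, hb.eval (4 * x) = 16 * ψ.eval x := by
    intro x; rw [hevb, hevψ]; ring
  have himage : hb.roots.toFinset = ψ.roots.toFinset.image (fun x => 4 * x) := by
    ext z
    simp only [Multiset.mem_toFinset, mem_roots hb0, mem_roots hψ0, Finset.mem_image, IsRoot.def]
    constructor
    · intro hz
      refine ⟨z / 4, ?_, mul_div_cancel₀ z h4⟩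
      have := hkey (z / 4)
      rw [mul_div_cancel₀ z h4, hz] at this
      have h16 : (16 : ZMod ℓ) ≠ 0 := by
        rw [show (16 : ZMod ℓ) = 4 * 4 by norm_num]
        exact mul_ne_zero h4 h4
      exact (mul_eq_zero.mp this.symm).resolve_left h16
    · rintro ⟨x, hx, rfl⟩
      rw [hkey, hx, mul_zero]
  rw [himage, Finset.card_image_of_injective _ (mul_right_injective₀ h4)]

/-- **`a_ℓ(W) + 1 + #{x ∈ 𝔽_ℓ : h_W(x) = 0}` is even** for a globally minimal `W/ℚ`, an odd prime
`ℓ ∤ Δ_min` and the monic integral 2-division cubic `h_W = X³ + b₂X² + 8b₄X + 16b₆`: the reduction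
`W̃/𝔽_ℓ` is nonsingular, `a_ℓ = ℓ + 1 − #W̃(𝔽_ℓ)` and `#W̃(𝔽_ℓ) ≡ 1 + #{roots of ψ₂} (mod 2)`
(Silverman, *AEC* III.2.3, V.2). [folklore] -/
theorem even_frobeniusTrace_add_one_add_card_roots {ℓ : ℕ} [Fact ℓ.Prime] (hℓ2 : ℓ ≠ 2)
    (hΔ : ¬ (ℓ : ℤ) ∣ minimalDiscriminantInt W) :
    Even (W.frobeniusTrace ℓ + 1 +
      (((MonicCubic.poly (integralModelInt W).b₂ (8 * (integralModelInt W).b₄)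
        (16 * (integralModelInt W).b₆)).map (Int.castRingHom (ZMod ℓ))).roots.toFinset.card : ℤ)) := by
  set E := (integralModelInt W).map (Int.castRingHom (ZMod ℓ)) with hE
  have h2 : (2 : ZMod ℓ) ≠ 0 := by
    intro h
    have := (ZMod.natCast_eq_zero_iff 2 ℓ).mp (by exact_mod_cast h)
    exact hℓ2 ((Nat.prime_dvd_prime_iff_eq (Fact.out) Nat.prime_two).mp this)
  have hΔE : E.Δ ≠ 0 := by
    rw [hE, map_Δ, eq_intCast, Ne, ZMod.intCast_zmod_eq_zero_iff_dvd]
    exact_mod_cast hΔ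
  haveI : NeZero ℓ := ⟨(Fact.out : ℓ.Prime).ne_zero⟩
  have hN : W.reductionPointCount ℓ % 2 = (1 + E.twoTorsionPolynomial.toPoly.roots.toFinset.card) % 2 := by
    rw [WeierstrassCurve.reductionPointCount]
    exact natCard_point_modEq E h2 hΔE
  rw [card_roots_twoDivisionCubic_eq W hℓ2, ← hE]
  have hodd : ℓ % 2 = 1 := Nat.odd_iff.mp ((Fact.out : ℓ.Prime).odd_of_ne_two hℓ2)
  rw [Int.even_iff, WeierstrassCurve.frobeniusTrace]
  omega

end Curve

end Summit.BirchSwinnertonDyer.BirchSwinnertonDyer.Theorems.HeckeThetaPartner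

end
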